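import Literature.NumberTheory.LFunctions.WeilGroundEnergyProofs
import Literature.NumberTheory.LFunctions.WeilExplicitRightEdge
import HarnessLib

/-!
# The window clause "the bottom of the truncated Weil form is simple, isolated and even"

Sibling of `Literature/NumberTheory/LFunctions/WeilExplicit.lean` (same normalisation:
`ĝ(s) = ∫ g(t) e^{(s - 1/2)t} dt`, `g̃(t) = conj g(-t)`, `Q(g) = W(g ⋆ g̃)`,
`ε(a) = weilGroundEnergy a`, test functions `IsWeilTest`, window `tsupport g ⊆ [-a, a]`).

## The notion

Connes–van Suijlekom (Comm. Math. Phys. 406 (2025), Thm. 6.1; announced as Thm. 1.2) prove: if the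
quadratic form attached to Weil's (even) distribution on a window defines a lower-bounded operator
*"and the minimum of its spectrum is a simple, isolated eigenvalue `λ`, with even eigenfunction
`ξ`"*, then the Fourier transform of `ξ` has only real zeros. Connes (arXiv:2602.04022, §6.6,
"Remaining steps") singles out exactly this hypothesis for the Weil quadratic form `QW_λ` as a
remaining step of his strategy towards RH. In the proof of Thm. 6.1 (p. 11) the hypothesis is used
in the variational form *"the spectrum of `A` is contained, except for the simple eigenvalue `λ`,
in `[λ + δ, ∞)` for some `δ > 0`; thus `⟨α ∣ α⟩_Q ≥ (λ + δ)‖α‖²` for all `α ⊥ ξ`"*.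

`WeilWindowSimpleEven a` records this hypothesis for the window `[-a, a]` of the tree's additive
normalisation, **variationally and without positing an operator**: there are a witness `φ` (the
ground state) and a gap `δ > 0` such that every `L²`-normalised ODD test function on the window,
and every `L²`-normalised EVEN test function on the window orthogonal to `φ`, has
`Re Q(g) ≥ ε(a) + δ`. Since `Q` is parity-block-diagonal (`weilQuadratic_add_of_even_odd` below;
Connes–Consani, arXiv:2106.01715 §2.1.3, `QW_λ = QW_λ⁺ ⊕ QW_λ⁻`), this says: the odd-sector bottom
and the second even level lie strictly above `ε(a)`, which is then the (simple) even bottom. It is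
the clause inlined verbatim (window `a`) by the route items `GroundStateSimpleEven`,
`GroundStateMellinRealZeros`, `ArchimedeanWindowSimpleEven`, `SmallWindowsSimpleEven` of
`Summits/RiemannHypothesis/RiemannHypothesis/Theses/WeilGroundState.lean`, so that those restate as
`∀ a, 0 < a → WeilWindowSimpleEven a` etc. by `Iff.rfl`.

## API (all proved)

* `weilFunctional_comp_neg`, `weilQuadratic_comp_neg` — parity invariance, hypothesis-free:
  `W(k(-·)) = W(k)` (the polar term is symmetric under `s ↦ 1 - s`, the prime term under
  `log n ↦ -log n`, and `Re ψ(1/4 + it/2)` is even in `t` by `ψ(s̄) = conj ψ(s)`), and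
  `(g(-·)) ⋆ (g(-·))̃ = (g ⋆ g̃)(-·)`, whence `Q(g(-·)) = Q(g)`.
* `weilFunctional_add` — additivity of `W` on test kernels (the archimedean integrand is
  integrable: `integrable_weilArchIntegrand`); `weilConv_add_left/right`, `weilReflect_add`.
* `weilFunctional_weilConv_weilReflect_eq_zero_of_even_odd` (and `…_of_odd_even`) — for `e` even
  and `o` odd the cross kernel `e ⋆ õ` is odd, so `W(e ⋆ õ) = 0` (hypothesis-free; the complex
  form of Connes–Consani Lemma 2.5 (iii)).
* `weilQuadratic_add` (polarisation with both cross terms), `weilQuadratic_add_of_even_odd`: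
  `Q(e + o) = Q(e) + Q(o)`, and `weilQuadratic_eq_evenPart_add_oddPart`:
  `Q(g) = Q(½(g + g(-·))) + Q(½(g - g(-·)))` for every test function `g`.
* `weilWindowSimpleEven_of_nonpos` — the documented junk regime: for `a ≤ 0` the clause holds
  vacuously (no test function on a null window has `L²`-norm `1`); the route only uses `0 < a`.

The property is NOT monotone in `a` (no monotonicity lemma is stated). Nothing here asserts the
clause for any `a > 0`: that is the open crux of the route, not literature.

## References

* A. Connes, W. D. van Suijlekom, *Quadratic Forms, Real Zeros and Echoes of the Spectral Action*,
  Comm. Math. Phys. 406 (2025), Thm. 1.2, §4, Thm. 6.1 (arXiv:2511.23257).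
* A. Connes, *The Riemann Hypothesis: Past, Present and a Letter Through Time* (2026),
  arXiv:2602.04022, §6.6.
* A. Connes, C. Consani, *Spectral triples and ζ-cycles*, Enseign. Math. 69 (2023), §2.1.3,
  Lemma 2.5 and eq. `QW_λ = QW_λ⁺ ⊕ QW_λ⁻` (arXiv:2106.01715).
* E. Bombieri, *Remarks on Weil's quadratic functional in the theory of prime numbers I*, Rend.
  Lincei (9) 11 (2000), §§2–4.
-/

noncomputable section

open Complex Filter Set MeasureTheory
open scoped Real Topology Convolution ComplexConjugate

namespace Literature.NumberTheory.LFunctions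

/-! ## The definition -/

/-- **The window-`a` clause "simple, isolated, even bottom" of the truncated Weil form**
(hypothesis of Connes–van Suijlekom, Comm. Math. Phys. 2025, Thm. 6.1, in the variational form
used in its proof, p. 11: the spectrum lies in `{λ} ∪ [λ + δ, ∞)` and `Q(α) ≥ (λ + δ)‖α‖²` for
`α ⊥ ξ`, `ξ` even; named as a remaining step in Connes 2026, §6.6). In the tree's normalisation:
there are a witness `φ : ℝ → ℂ` (the ground state; not required to be a test function) and
`δ > 0` such that for every test function `g` with `tsupport g ⊆ [-a, a]` and `∫ ‖g‖² = 1`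
which is either ODD, or EVEN and orthogonal to `φ` (`∫ conj φ · g = 0`), one has
`ε(a) + δ ≤ Re Q(g)`, where `ε(a) = weilGroundEnergy a` and `Q = weilQuadratic`.
Junk regime: for `a ≤ 0` the clause is vacuously true (`weilWindowSimpleEven_of_nonpos`); it is
meant for `0 < a`. The parity conditions are `Function.Odd g` / `Function.Even g` spelled out.
[cite: ConnesSuijlekom2025, Thm. 6.1 (hypothesis) and its proof p. 11] -/
def WeilWindowSimpleEven (a : ℝ) : Prop :=
  ∃ φ : ℝ → ℂ, ∃ δ : ℝ, 0 < δ ∧ ∀ g : ℝ → ℂ, IsWeilTest g → tsupport g ⊆ Icc (-a) a →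
    ∫ t, ‖g t‖ ^ 2 = (1 : ℝ) →
    ((∀ t, g (-t) = -g t) ∨ ((∀ t, g (-t) = g t) ∧ ∫ t, starRingEnd ℂ (φ t) * g t = 0)) →
    weilGroundEnergy a + δ ≤ (weilQuadratic g).re

/-- The junk regime of `WeilWindowSimpleEven`: for `a ≤ 0` the window `Icc (-a) a` is Lebesgue-null,
so a function with `tsupport g ⊆ Icc (-a) a` vanishes a.e. and `∫ ‖g‖² = 0 ≠ 1`; the clause holds
vacuously (witness `φ = 0`, `δ = 1`). [folklore] -/
theorem weilWindowSimpleEven_of_nonpos {a : ℝ} (ha : a ≤ 0) : WeilWindowSimpleEven a := by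
  refine ⟨0, 1, one_pos, fun g _ hsupp hnorm _ ↦ ?_⟩
  exfalso
  have hvol : volume (Icc (-a) a) = 0 := by
    rw [Real.volume_Icc, ENNReal.ofReal_eq_zero]
    linarith
  have hae : (fun t : ℝ ↦ ‖g t‖ ^ 2) =ᵐ[volume] fun _ ↦ (0 : ℝ) := by
    filter_upwards [measure_eq_zero_iff_ae_notMem.1 hvol] with t ht
    rw [image_eq_zero_of_notMem_tsupport fun h ↦ ht (hsupp h), norm_zero, zero_pow two_ne_zero]
  rw [integral_congr_ae hae, integral_zero] at hnorm
  exact zero_ne_one hnorm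

/-! ## Reflection `t ↦ -t`: parity invariance of the Weil functional -/

section Reflection

variable (g h k : ℝ → ℂ)

/-- Reflection commutes with convolution: `(g(-·)) ⋆ (h(-·)) = (g ⋆ h)(-·)` (substitute `u ↦ -u`;
no hypotheses, both sides carry the same junk values). [folklore] -/
theorem weilConv_comp_neg :
    weilConv (fun t ↦ g (-t)) (fun t ↦ h (-t)) = fun t ↦ weilConv g h (-t) := by
  funext t
  rw [weilConv_apply, weilConv_apply,
    ← integral_neg_eq_self (fun u : ℝ ↦ g u * h (-t - u)) volume]
  congr 1 with u
  rw [show -(t - u) = -t - -u by ring]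

/-- Reflection commutes with the involution: `(g(-·))̃ = g̃(-·)` (definitional). [folklore] -/
theorem weilReflect_comp_neg : weilReflect (fun t ↦ g (-t)) = fun t ↦ weilReflect g (-t) := rfl

/-- The polar term is reflection invariant: `(k(-·))^(0) + (k(-·))^(1) = k̂(1) + k̂(0)`
(`weilMellin_comp_neg`: `(k(-·))^(s) = k̂(1 - s)`). [folklore] -/
theorem weilPolarTerm_comp_neg : weilPolarTerm (fun t ↦ k (-t)) = weilPolarTerm k := by
  rw [weilPolarTerm, weilPolarTerm, weilMellin_comp_neg, weilMellin_comp_neg, sub_zero, sub_self,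
    add_comm]

/-- The prime term is reflection invariant (it only involves `k(log n) + k(-log n)`). [folklore] -/
theorem weilPrimeTerm_comp_neg : weilPrimeTerm (fun t ↦ k (-t)) = weilPrimeTerm k := by
  unfold weilPrimeTerm
  refine tsum_congr fun n ↦ ?_
  dsimp only
  rw [neg_neg, add_comm (k (-Real.log n))]

/-- The archimedean integral is reflection invariant: `(k(-·))^(1/2 + it) = k̂(1/2 - it)`, and
`Re ψ(1/4 + it/2)` is even in `t` since `ψ(s̄) = conj ψ(s)` (`digamma_conj`); substitute
`t ↦ -t`. No hypotheses. [folklore] -/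
theorem weilArchIntegral_comp_neg : weilArchIntegral (fun t ↦ k (-t)) = weilArchIntegral k := by
  unfold weilArchIntegral
  rw [← integral_neg_eq_self (fun t : ℝ ↦ weilMellin k (1 / 2 + t * I) *
    ((Complex.digamma (1 / 4 + t / 2 * I)).re : ℂ)) volume]
  congr 1 with t
  rw [weilMellin_comp_neg, quarter_add_neg_mul_I, digamma_conj, Complex.conj_re]
  congr 2
  push_cast
  ring

/-- The archimedean term is reflection invariant. [folklore] -/
theorem weilArchTerm_comp_neg : weilArchTerm (fun t ↦ k (-t)) = weilArchTerm k := by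
  rw [weilArchTerm, weilArchTerm, weilArchIntegral_comp_neg, neg_zero]

/-- **Parity invariance of the Weil functional**: `W(k(-·)) = W(k)` for every `k : ℝ → ℂ`
(Weil's distribution is even: the polar term is symmetric under `s ↦ 1 - s`, the prime term under
`log n ↦ -log n`, the archimedean density under `t ↦ -t`; cf. Connes–van Suijlekom 2025 §4, the
even distribution `D̃`). Hypothesis-free. [folklore] -/
theorem weilFunctional_comp_neg : weilFunctional (fun t ↦ k (-t)) = weilFunctional k := by
  rw [weilFunctional, weilFunctional, weilPolarTerm_comp_neg, weilPrimeTerm_comp_neg,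
    weilArchTerm_comp_neg]

/-- **Parity invariance of Weil's quadratic functional**: `Q(g(-·)) = Q(g)` for every `g : ℝ → ℂ`
(`(g(-·)) ⋆ (g(-·))̃ = (g ⋆ g̃)(-·)` and `weilFunctional_comp_neg`). Hypothesis-free; in
particular `Re Q` takes the same values on a test function and on its reflection, so the ground
energy `ε(a)` on the symmetric window `[-a, a]` is approached by even and by odd test functions
separately (`weilQuadratic_add_of_even_odd`). [folklore] -/
theorem weilQuadratic_comp_neg : weilQuadratic (fun t ↦ g (-t)) = weilQuadratic g := by
  unfold weilQuadratic
  rw [weilReflect_comp_neg, weilConv_comp_neg, weilFunctional_comp_neg]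

end Reflection

/-! ## Constants and sums through `⋆` and `̃` -/

section Linear

variable {g g₁ g₂ h h₁ h₂ k k₁ k₂ : ℝ → ℂ}

/-- `g ⋆ (c h) = c (g ⋆ h)` (no hypotheses). [folklore] -/
theorem weilConv_const_mul_right (c : ℂ) (g h : ℝ → ℂ) :
    weilConv g (fun t ↦ c * h t) = fun t ↦ c * weilConv g h t := by
  funext t
  rw [weilConv_apply, weilConv_apply, ← integral_const_mul]
  congr 1 with u
  ring

/-- `(c g) ⋆ h = c (g ⋆ h)` (no hypotheses). [folklore] -/
theorem weilConv_const_mul_left (c : ℂ) (g h : ℝ → ℂ) :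
    weilConv (fun t ↦ c * g t) h = fun t ↦ c * weilConv g h t := by
  funext t
  rw [weilConv_apply, weilConv_apply, ← integral_const_mul]
  congr 1 with u
  ring

/-- `(c g)̃ = conj c · g̃`. [folklore] -/
theorem weilReflect_const_mul (c : ℂ) (g : ℝ → ℂ) :
    weilReflect (fun t ↦ c * g t) = fun t ↦ conj c * weilReflect g t := by
  funext t
  simp [weilReflect]

/-- `(g + h)̃ = g̃ + h̃`. [folklore] -/
theorem weilReflect_add (g h : ℝ → ℂ) : weilReflect (g + h) = weilReflect g + weilReflect h := by
  funext t
  simp [weilReflect]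

/-- `(g₁ + g₂) ⋆ h = g₁ ⋆ h + g₂ ⋆ h` for test functions (the convolutions exist:
`HasCompactSupport.convolutionExists_right`, `ConvolutionExists.add_distrib`). [folklore] -/
theorem weilConv_add_left (hg₁ : IsWeilTest g₁) (hg₂ : IsWeilTest g₂) (hh : IsWeilTest h) :
    weilConv (g₁ + g₂) h = weilConv g₁ h + weilConv g₂ h :=
  ConvolutionExists.add_distrib
    (hh.2.convolutionExists_right _ hg₁.1.continuous.locallyIntegrable hh.1.continuous)
    (hh.2.convolutionExists_right _ hg₂.1.continuous.locallyIntegrable hh.1.continuous)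

/-- `g ⋆ (h₁ + h₂) = g ⋆ h₁ + g ⋆ h₂` for test functions. [folklore] -/
theorem weilConv_add_right (hg : IsWeilTest g) (hh₁ : IsWeilTest h₁) (hh₂ : IsWeilTest h₂) :
    weilConv g (h₁ + h₂) = weilConv g h₁ + weilConv g h₂ :=
  ConvolutionExists.distrib_add
    (hh₁.2.convolutionExists_right _ hg.1.continuous.locallyIntegrable hh₁.1.continuous)
    (hh₂.2.convolutionExists_right _ hg.1.continuous.locallyIntegrable hh₂.1.continuous)

/-- The archimedean integrand `t ↦ k̂(1/2 + it) · Re ψ(1/4 + it/2)` of `weilArchIntegral k` is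
integrable for every test function `k` (`|k̂| ≤ D/(1 + t²)²` on the critical line and
`|ψ(1/4 + it/2)| ≤ C + log(1 + |t|)`). [folklore] -/
theorem integrable_weilArchIntegrand (hk : IsWeilTest k) :
    Integrable fun t : ℝ ↦ weilMellin k (1 / 2 + t * I) *
      ((Complex.digamma (1 / 4 + t / 2 * I)).re : ℂ) := by
  obtain ⟨C, hC⟩ :=
    Literature.Analysis.SpecialFunctions.Complex.exists_norm_digamma_vertical_le
      (a := 1 / 4) (by norm_num)
  set F : ℝ → ℂ := fun t ↦ ((Complex.digamma (1 / 4 + t / 2 * I)).re : ℂ) with hF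
  have hw : ∀ t : ℝ, (1 / 4 : ℂ) + (t : ℂ) / 2 * I = ((1 / 4 : ℝ) : ℂ) + ((t / 2 : ℝ) : ℂ) * I := by
    intro t
    push_cast
    ring
  have hFc : Continuous F := by
    refine continuous_ofReal.comp (Complex.continuous_re.comp ?_)
    refine Literature.Analysis.SpecialFunctions.Complex.continuousOn_digamma.comp_continuous
      (by fun_prop) fun t ↦ ?_
    rw [hw t]
    simp
  have hFb : ∀ t : ℝ, ‖F t‖ ≤ C + Real.log (1 + |t|) := by
    intro t
    have h1 : ‖F t‖ ≤ ‖Complex.digamma (1 / 4 + t / 2 * I)‖ := by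
      simp only [hF, Complex.norm_real, Real.norm_eq_abs]
      exact Complex.abs_re_le_norm _
    have h2 := hC (t / 2)
    rw [← hw t] at h2
    have h3 : Real.log (1 + |t / 2|) ≤ Real.log (1 + |t|) := by
      refine Real.log_le_log (by positivity) ?_
      rw [abs_div, abs_two]
      linarith [abs_nonneg t]
    linarith
  have hI := integrable_mul_weilMellin_vertical_of_norm_le_log hk (1 / 2) hFc hFb
  refine hI.congr (Eventually.of_forall fun t ↦ ?_)
  simp only [hF]
  rw [mul_comm]
  push_cast
  ring_nf

/-- Additivity of the archimedean integral on test kernels. [folklore] -/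
theorem weilArchIntegral_add (hk₁ : IsWeilTest k₁) (hk₂ : IsWeilTest k₂) :
    weilArchIntegral (k₁ + k₂) = weilArchIntegral k₁ + weilArchIntegral k₂ := by
  unfold weilArchIntegral
  rw [← integral_add (integrable_weilArchIntegrand hk₁) (integrable_weilArchIntegrand hk₂)]
  congr 1 with t
  rw [weilMellin_add hk₁.1.continuous hk₁.2 hk₂.1.continuous hk₂.2]
  ring

/-- **Additivity of the Weil functional on test kernels**: `W(k₁ + k₂) = W(k₁) + W(k₂)`
(`ĝ`, the prime sum and the archimedean integral are additive; the latter two need the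
summability / integrability supplied by the test-function hypotheses). [folklore] -/
theorem weilFunctional_add (hk₁ : IsWeilTest k₁) (hk₂ : IsWeilTest k₂) :
    weilFunctional (k₁ + k₂) = weilFunctional k₁ + weilFunctional k₂ := by
  have hM := weilMellin_add hk₁.1.continuous hk₁.2 hk₂.1.continuous hk₂.2
  have hP : weilPolarTerm (k₁ + k₂) = weilPolarTerm k₁ + weilPolarTerm k₂ := by
    simp only [weilPolarTerm, hM]
    ring
  have hPr : weilPrimeTerm (k₁ + k₂) = weilPrimeTerm k₁ + weilPrimeTerm k₂ := by
    unfold weilPrimeTerm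
    rw [← (summable_weilPrimeTerm hk₁.2).tsum_add (summable_weilPrimeTerm hk₂.2)]
    refine tsum_congr fun n ↦ ?_
    simp only [Pi.add_apply]
    ring
  have hA : weilArchTerm (k₁ + k₂) = weilArchTerm k₁ + weilArchTerm k₂ := by
    simp only [weilArchTerm, weilArchIntegral_add hk₁ hk₂, Pi.add_apply]
    ring
  simp only [weilFunctional, hP, hPr, hA]
  ring

end Linear

/-! ## Parity: cross terms vanish, `Q` is block-diagonal -/

section Parity

variable {e o g h : ℝ → ℂ}

/-- For `e` even and `o` odd the cross kernel `e ⋆ õ` is odd (`(e ⋆ õ)(-·) = e(-·) ⋆ (o(-·))̃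
= -(e ⋆ õ)`), hence `W(e ⋆ õ) = W((e ⋆ õ)(-·)) = -W(e ⋆ õ) = 0`. Hypothesis-free beyond parity
(the complex form of Connes–Consani 2023, Lemma 2.5 (iii)).
[cite: ConnesConsani2023, §2.1.3 Lemma 2.5 (iii)] -/
theorem weilFunctional_weilConv_weilReflect_eq_zero_of_even_odd
    (he : ∀ t, e (-t) = e t) (ho : ∀ t, o (-t) = -o t) :
    weilFunctional (weilConv e (weilReflect o)) = 0 := by
  have h1 : (fun t ↦ e (-t)) = e := funext he
  have h2 : (fun t ↦ o (-t)) = fun t ↦ (-1 : ℂ) * o t := funext fun t ↦ by rw [ho, neg_one_mul]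
  have hodd : (fun t ↦ weilConv e (weilReflect o) (-t)) =
      fun t ↦ (-1 : ℂ) * weilConv e (weilReflect o) t := by
    rw [← weilConv_comp_neg, ← weilReflect_comp_neg, h1, h2, weilReflect_const_mul, map_neg, map_one,
      weilConv_const_mul_right]
  have h := weilFunctional_comp_neg (weilConv e (weilReflect o))
  rw [hodd, weilFunctional_const_mul] at h
  linear_combination (-1 / 2 : ℂ) * h

/-- Symmetric companion: for `o` odd and `e` even, `W(o ⋆ ẽ) = 0`.
[cite: ConnesConsani2023, §2.1.3 Lemma 2.5 (iii)] -/
theorem weilFunctional_weilConv_weilReflect_eq_zero_of_odd_even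
    (ho : ∀ t, o (-t) = -o t) (he : ∀ t, e (-t) = e t) :
    weilFunctional (weilConv o (weilReflect e)) = 0 := by
  have h1 : (fun t ↦ e (-t)) = e := funext he
  have h2 : (fun t ↦ o (-t)) = fun t ↦ (-1 : ℂ) * o t := funext fun t ↦ by rw [ho, neg_one_mul]
  have hodd : (fun t ↦ weilConv o (weilReflect e) (-t)) =
      fun t ↦ (-1 : ℂ) * weilConv o (weilReflect e) t := by
    rw [← weilConv_comp_neg, ← weilReflect_comp_neg, h1, h2, weilConv_const_mul_left]
  have h := weilFunctional_comp_neg (weilConv o (weilReflect e))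
  rw [hodd, weilFunctional_const_mul] at h
  linear_combination (-1 / 2 : ℂ) * h

/-- **Polarisation of `Q` over a sum** of test functions:
`Q(g + h) = Q(g) + Q(h) + (W(g ⋆ h̃) + W(h ⋆ g̃))` (bi-additivity of `⋆`, additivity of `̃` and
of `W` on test kernels; Bombieri 2000 §4 / Yoshida 1992: `T[f * f̄*]` is a hermitian form).
[cite: Bombieri2000Weil, §3 (the hermitian form attached to T)] -/
theorem weilQuadratic_add (hg : IsWeilTest g) (hh : IsWeilTest h) :
    weilQuadratic (g + h) = weilQuadratic g + weilQuadratic h +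
      (weilFunctional (weilConv g (weilReflect h)) + weilFunctional (weilConv h (weilReflect g))) := by
  have hg' := hg.weilReflect
  have hh' := hh.weilReflect
  unfold weilQuadratic
  rw [weilReflect_add, weilConv_add_left hg hh (hg'.add hh'), weilConv_add_right hg hg' hh',
    weilConv_add_right hh hg' hh',
    weilFunctional_add ((hg.weilConv hg').add (hg.weilConv hh')) ((hh.weilConv hg').add (hh.weilConv hh')),
    weilFunctional_add (hg.weilConv hg') (hg.weilConv hh'),
    weilFunctional_add (hh.weilConv hg') (hh.weilConv hh')]
  ring

/-- **`Q` is parity-block-diagonal**: for test functions `e` even and `o` odd,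
`Q(e + o) = Q(e) + Q(o)` (the cross terms vanish,
`weilFunctional_weilConv_weilReflect_eq_zero_of_even_odd`). This is the decomposition
`QW_λ = QW_λ⁺ ⊕ QW_λ⁻` of Connes–Consani 2023, §2.1.3, in the tree's normalisation.
[cite: ConnesConsani2023, §2.1.3 eq. QW_λ = QW_λ⁺ ⊕ QW_λ⁻] -/
theorem weilQuadratic_add_of_even_odd (he : IsWeilTest e) (ho : IsWeilTest o)
    (hev : ∀ t, e (-t) = e t) (hodd : ∀ t, o (-t) = -o t) :
    weilQuadratic (e + o) = weilQuadratic e + weilQuadratic o := by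
  rw [weilQuadratic_add he ho, weilFunctional_weilConv_weilReflect_eq_zero_of_even_odd hev hodd,
    weilFunctional_weilConv_weilReflect_eq_zero_of_odd_even hodd hev, add_zero, add_zero]

/-- The even part `½(g + g(-·))` of a test function is a test function. [folklore] -/
theorem IsWeilTest.evenPart (hg : IsWeilTest g) : IsWeilTest fun t ↦ (g t + g (-t)) / 2 := by
  have h := (hg.add hg.comp_neg).const_mul (1 / 2)
  convert h using 1
  funext t
  simp only [Pi.add_apply]
  ring

/-- The odd part `½(g - g(-·))` of a test function is a test function. [folklore] -/
theorem IsWeilTest.oddPart (hg : IsWeilTest g) : IsWeilTest fun t ↦ (g t - g (-t)) / 2 := by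
  have h := (hg.add (hg.comp_neg.const_mul (-1))).const_mul (1 / 2)
  convert h using 1
  funext t
  simp only [Pi.add_apply]
  ring

/-- **Parity splitting of `Q`**: for every test function `g`,
`Q(g) = Q(½(g + g(-·))) + Q(½(g - g(-·)))` (`g` = even part + odd part and
`weilQuadratic_add_of_even_odd`). [cite: ConnesConsani2023, §2.1.3 eq. QW_λ = QW_λ⁺ ⊕ QW_λ⁻] -/
theorem weilQuadratic_eq_evenPart_add_oddPart (hg : IsWeilTest g) :
    weilQuadratic g =
      weilQuadratic (fun t ↦ (g t + g (-t)) / 2) + weilQuadratic (fun t ↦ (g t - g (-t)) / 2) := by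
  have hsum : g = (fun t ↦ (g t + g (-t)) / 2) + fun t ↦ (g t - g (-t)) / 2 := by
    funext t
    simp only [Pi.add_apply]
    ring
  conv_lhs => rw [hsum]
  refine weilQuadratic_add_of_even_odd hg.evenPart hg.oddPart (fun t ↦ ?_) (fun t ↦ ?_)
  · simp only [neg_neg]
    ring
  · simp only [neg_neg]
    ring

/-- Real-part form used by the route statements: for test functions `e` even and `o` odd,
`Re Q(e + o) = Re Q(e) + Re Q(o)`. [cite: ConnesConsani2023, §2.1.3 eq. QW_λ = QW_λ⁺ ⊕ QW_λ⁻] -/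
theorem weilQuadratic_re_add_of_even_odd (he : IsWeilTest e) (ho : IsWeilTest o)
    (hev : ∀ t, e (-t) = e t) (hodd : ∀ t, o (-t) = -o t) :
    (weilQuadratic (e + o)).re = (weilQuadratic e).re + (weilQuadratic o).re := by
  rw [weilQuadratic_add_of_even_odd he ho hev hodd, Complex.add_re]

end Parity

end Literature.NumberTheory.LFunctions
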